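import Summits.BirchSwinnertonDyer.BirchSwinnertonDyer.Theorems.ByReductionTypeAtTwoFineSelmerConjAAtTwoAdditivePotGoodTwoLayerDoorEvenIndex
import Summits.BirchSwinnertonDyer.BirchSwinnertonDyer.Theorems.ByReductionTypeAtTwoFineSelmerConjAAtTwoAdditivePotGoodClassNumberOne780
import HarnessLib

/-!
# Route `ByReductionTypeAtTwo` (rung K4), crux C1″ `FineSelmerConjAAtTwoAdditivePotGood` (item stmt-BirchSwinnertonDyer-22615):
# TWO-LAYER STAMPS, EVEN-INDEX TYPE `2 = 𝔭²𝔮`, part A — the census rows `237952bv1` (cubic field of discriminant `−104`) and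
# `261648q1` (discriminant `316`): `h = 1` by explicit Minkowski certificates (kernel), Fukuda's index `0` by even-index
# certificates (kernel), hence (A)₂ modulo `hLim2` and ONE displayed bit — the parity of `h(F(√2))` (census: `Cl(F(√2)) = []`)
# (a `--supports 22615` file; seat `bsd-2adic-k4-w1` GEN 5; first consumers of `…TwoLayerDoorEvenIndex`)

HONEST FRAMING (cell `bsd-2adic`, D-0036/D-0054/D-0152): per-class stamps; conditional on `hLim2` (Lim 2017 Thm. 3.5 at `2`) BY NAME and on
ONE displayed bit per row, «`e_1 = 0` along the cyclotomic `ℤ₂`-extensions of `ℚ(θ)`» = `2 ∤ h(ℚ(θ, √2))` (`…TwoLayerDoor` §2; census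
column `cyc6 = []` of `addL2x/gen5/conjA2_census_j289938_classes.tsv`, PARI — NOT kernel). Everything else is KERNEL: irreducibility,
`h(ℚ(θ)) = 1` (explicit Minkowski certificates, GEN 4's `…ExplicitMinkowski` toolkit), `ℚ(P) = ℚ(θ)` (explicit change of generator),
the even-index certificate (four vectors per field, found by the seat's `gen/cert_search.py`, verified as ring identities + one companion
determinant), Fukuda's index `0` (`totallyRamifiedFrom_zero_of_evenIndexCertificate`, p689647) and Fukuda's Thm. 1 (1) (`_holds`).
Closes nothing at the `∀`-level; nothing booked; BSD is not proved by any of this. BOTH ROWS LEAVE `C1″-RES` FOR THE DOOR SIDE.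

THE FIELDS. `d = −104`: `ℚ(θ)`, `θ³ = θ + 2` (`X³ − X − 2`, no root mod `3`; `2 = 𝔭²𝔮`: `X(X + 1)² mod 2`); `M < 3`, the two primes of norm `2`
are `(θ)` (`N = 2`) and `(θ − 1)` (`N = 2`). `d = 316`: `ℚ(θ)`, `θ³ = θ² + 4θ − 2` (`X³ − X² − 4X + 2`, no root mod `3`); `M < 6`: norm `2`:
`(θ)`, `(θ − 1)`; norm `3`, `5`: no root; norm `4`: `θ²(θ − 1) = 2(2θ − 1)` puts a norm-`2` element in the ideal.

References: [Fukuda1994] Thm. 1 (1); [Lim2017FineSelmer] Thm. 3.5, Lemma 3.2; [CoatesSujatha2005] (A); [Marcus1977] Ch. 5 Thm. 37;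
[Cohen1993] App. B (d = −104, 316: h = 1); cell TSV `addL2x/gen5/conjA2_census_j289938_classes.tsv` (rows 237952bv1, 261648q1).
-/

set_option autoImplicit false
-- sibling precedent (`…TwoLayerDoorEvenIndex.lean`): the directory name repeats the summit name
set_option linter.dupNamespace false

noncomputable section

open scoped Classical IntermediateField NumberField Real nonZeroDivisors

namespace Summit.BirchSwinnertonDyer.BirchSwinnertonDyer.Theorems.AddKatoTwo

open WeierstrassCurve Field Polynomial IsDedekindDomain NumberField Matrix Literature.NumberTheory.EllipticCurves
  Literature.NumberTheory.GaloisRepresentations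
  Literature.NumberTheory.IwasawaTheory
  Summit.BirchSwinnertonDyer.BirchSwinnertonDyer.Theorems.AlignedTransportAtTwoTorsionPointField
  Summit.BirchSwinnertonDyer.BirchSwinnertonDyer.Theses.ByReductionTypeAtTwo

/-! ## §1 The field of discriminant `−104` (`X³ − X − 2`): class number one -/

/-- `X³ − X − 2` is irreducible over `ℚ` (no root mod `3`). -/
theorem irreducible_cubic_d104n : Irreducible (Cubic.toPoly ⟨1, ((0 : ℤ) : ℚ), ((-1 : ℤ) : ℚ), ((-2 : ℤ) : ℚ)⟩) :=
  haveI : Fact (Nat.Prime 3) := ⟨by norm_num⟩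
  irreducible_cubic_of_no_root_zmod 3 (by decide)

section Cert104

variable (K : Type) [Field K] [NumberField K]

/-- Norms of `θ` and `θ − 1` in the field of `X³ − X − 2`: `2, 2`. -/
private theorem dets_d104n :
    (((0 : ℤ) : ℚ) • (1 : Matrix (Fin 3) (Fin 3) ℚ) + ((1 : ℤ) : ℚ) • !![(0 : ℚ), 0, -(-2 : ℤ); 1, 0, -(-1 : ℤ); 0, 1, -(0 : ℤ)] +
        ((0 : ℤ) : ℚ) • !![(0 : ℚ), 0, -(-2 : ℤ); 1, 0, -(-1 : ℤ); 0, 1, -(0 : ℤ)] ^ 2).det = 2 ∧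
    (((-1 : ℤ) : ℚ) • (1 : Matrix (Fin 3) (Fin 3) ℚ) + ((1 : ℤ) : ℚ) • !![(0 : ℚ), 0, -(-2 : ℤ); 1, 0, -(-1 : ℤ); 0, 1, -(0 : ℤ)] +
        ((0 : ℤ) : ℚ) • !![(0 : ℚ), 0, -(-2 : ℤ); 1, 0, -(-1 : ℤ); 0, 1, -(0 : ℤ)] ^ 2).det = 2 := by
  refine ⟨?_, ?_⟩ <;>
    · simp only [Matrix.one_fin_three, Matrix.det_fin_three, Matrix.add_apply, Matrix.smul_apply, sq, Matrix.mul_apply,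
      Fin.sum_univ_three, Matrix.of_apply, Matrix.cons_val', Matrix.cons_val_zero, Matrix.cons_val_one, Matrix.cons_val_two,
      Matrix.head_cons, Matrix.tail_cons, Matrix.empty_val', Matrix.cons_val_fin_one, smul_eq_mul]; norm_num

/-- **`h = 1` for every cubic number field containing a root of `X³ − X − 2`** (the complex cubic field of discriminant `−104`,
`2 = 𝔭²𝔮`): `M_K < 3` and both primes of norm `2` are principal (`(θ)`, `(θ − 1)`). KERNEL. [cite: Marcus1977, Ch. 5 Thm. 37 and Cor. 2]
[cite: Cohen1993, App. B (complex cubic fields: d = −104, h = 1)] -/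
theorem classNumber_eq_one_of_root_d104n (h3 : Module.finrank ℚ K = 3) (b : 𝓞 K)
    (hb : b ^ 3 + (0 : ℤ) * b ^ 2 + (-1 : ℤ) * b + (-2 : ℤ) = 0) : NumberField.classNumber K = 1 := by
  have hirr := irreducible_cubic_d104n
  have hd : |NumberField.discr K| ≤ (104 : ℕ) :=
    (abs_discr_le_abs_cubic_discr K h3 b hirr hb).trans (by simp only [Cubic.discr]; norm_num)
  have hM := minkowskiBound_lt_of_sqrt_le K h3 hd (s := 10.2) (B := 3)
    ((Real.sqrt_le_sqrt (by norm_num : ((104 : ℕ) : ℝ) ≤ (10.2 : ℝ) ^ 2)).trans (Real.sqrt_sq (by norm_num)).le)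
    (by norm_num)
  obtain ⟨hN2a, hN2b⟩ := dets_d104n
  rw [NumberField.classNumber_eq_one_iff]
  refine RingOfIntegers.isPrincipalIdealRing_of_isPrincipal_of_norm_le_of_isPrime fun I hI hle ↦ ?_
  have hlt : Ideal.absNorm (I : Ideal (𝓞 K)) < 3 := by exact_mod_cast hle.trans_lt hM
  have h0 : Ideal.absNorm (I : Ideal (𝓞 K)) ≠ 0 := Ideal.absNorm_ne_zero_of_nonZeroDivisors I
  have h1 : Ideal.absNorm (I : Ideal (𝓞 K)) ≠ 1 := by rw [Ne, Ideal.absNorm_eq_one_iff]; exact hI.ne_top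
  have nα2a := natAbs_norm_coords_eq K h3 b hirr hb 0 1 0 (n := 2) hN2a (by norm_num)
  have nα2b := natAbs_norm_coords_eq K h3 b hirr hb (-1) 1 0 (n := 2) hN2b (by norm_num)
  have hn : Ideal.absNorm (I : Ideal (𝓞 K)) = 2 := by omega
  obtain ⟨a, ha, hab⟩ := exists_sub_natCast_mem_of_absNorm_eq_prime K (by norm_num) hn b
  interval_cases a
  · refine ⟨⟨_, eq_span_singleton_of_mem_of_absNorm_eq K two_ne_zero hn ?_ nα2a⟩⟩
    have : (((0 : ℤ) : 𝓞 K) + ((1 : ℤ) : 𝓞 K) * b + ((0 : ℤ) : 𝓞 K) * b ^ 2) = b - ((0 : ℕ) : 𝓞 K) := by push_cast; ring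
    rw [this]; exact hab
  · refine ⟨⟨_, eq_span_singleton_of_mem_of_absNorm_eq K two_ne_zero hn ?_ nα2b⟩⟩
    have : (((-1 : ℤ) : 𝓞 K) + ((1 : ℤ) : 𝓞 K) * b + ((0 : ℤ) : 𝓞 K) * b ^ 2) = b - ((1 : ℕ) : 𝓞 K) := by push_cast; ring
    rw [this]; exact hab

end Cert104

/-- `#Cl(𝓞 ℚ(θ)) = 1` for every root `θ` of `X³ − X − 2`. KERNEL. [cite: Cohen1993, App. B (d = −104)] -/
theorem card_classGroup_adjoin_eq_one_disc_neg104 {θ : AlgebraicClosure ℚ}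
    (hθ : aeval θ (Cubic.toPoly ⟨1, ((0 : ℤ) : ℚ), ((-1 : ℤ) : ℚ), ((-2 : ℤ) : ℚ)⟩) = 0) :
    Nat.card (ClassGroup (𝓞 (IntermediateField.adjoin ℚ {θ}))) = 1 := by
  have hfm : (Cubic.toPoly ⟨1, ((0 : ℤ) : ℚ), ((-1 : ℤ) : ℚ), ((-2 : ℤ) : ℚ)⟩).Monic := Cubic.monic_of_a_eq_one'
  have hθint : IsIntegral ℚ θ := ⟨_, hfm, by rwa [← aeval_def]⟩
  haveI : FiniteDimensional ℚ (IntermediateField.adjoin ℚ {θ}) := IntermediateField.adjoin.finiteDimensional hθint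
  haveI : NumberField (IntermediateField.adjoin ℚ {θ}) := NumberField.mk
  obtain ⟨b, -, hb⟩ := exists_ringOfIntegers_cubic_root (p := 0) (q := -1) (r := -2) hθ
  have h1 := classNumber_eq_one_of_root_d104n _ (finrank_adjoin_eq_three_of_irreducible irreducible_cubic_d104n hθ) b hb
  rw [NumberField.classNumber, ← Nat.card_eq_fintype_card] at h1
  exact h1

/-! ## §2 The field of discriminant `316` (`X³ − X² − 4X + 2`): class number one -/

/-- `X³ − X² − 4X + 2` is irreducible over `ℚ` (no root mod `3`). -/
theorem irreducible_cubic_d316p : Irreducible (Cubic.toPoly ⟨1, ((-1 : ℤ) : ℚ), ((-4 : ℤ) : ℚ), ((2 : ℤ) : ℚ)⟩) :=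
  haveI : Fact (Nat.Prime 3) := ⟨by norm_num⟩
  irreducible_cubic_of_no_root_zmod 3 (by decide)

section Cert316

variable (K : Type) [Field K] [NumberField K]

/-- Norms of `θ` and `θ − 1` in the field of `X³ − X² − 4X + 2`: `−2, 2`. -/
private theorem dets_d316p :
    (((0 : ℤ) : ℚ) • (1 : Matrix (Fin 3) (Fin 3) ℚ) + ((1 : ℤ) : ℚ) • !![(0 : ℚ), 0, -(2 : ℤ); 1, 0, -(-4 : ℤ); 0, 1, -(-1 : ℤ)] +
        ((0 : ℤ) : ℚ) • !![(0 : ℚ), 0, -(2 : ℤ); 1, 0, -(-4 : ℤ); 0, 1, -(-1 : ℤ)] ^ 2).det = -2 ∧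
    (((-1 : ℤ) : ℚ) • (1 : Matrix (Fin 3) (Fin 3) ℚ) + ((1 : ℤ) : ℚ) • !![(0 : ℚ), 0, -(2 : ℤ); 1, 0, -(-4 : ℤ); 0, 1, -(-1 : ℤ)] +
        ((0 : ℤ) : ℚ) • !![(0 : ℚ), 0, -(2 : ℤ); 1, 0, -(-4 : ℤ); 0, 1, -(-1 : ℤ)] ^ 2).det = 2 := by
  refine ⟨?_, ?_⟩ <;>
    · simp only [Matrix.one_fin_three, Matrix.det_fin_three, Matrix.add_apply, Matrix.smul_apply, sq, Matrix.mul_apply,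
      Fin.sum_univ_three, Matrix.of_apply, Matrix.cons_val', Matrix.cons_val_zero, Matrix.cons_val_one, Matrix.cons_val_two,
      Matrix.head_cons, Matrix.tail_cons, Matrix.empty_val', Matrix.cons_val_fin_one, smul_eq_mul]; norm_num

/-- **`h = 1` for every cubic number field containing a root of `X³ − X² − 4X + 2`** (the totally real field of discriminant `316`,
`2 = 𝔭²𝔮`): `M_K < 6`; norm `2`: `(θ)`, `(θ − 1)`; norms `3, 5`: no root; norm `4`: `θ²(θ − 1) = 2(2θ − 1)` forces a norm-`2` element
into the ideal. KERNEL. [cite: Marcus1977, Ch. 5 Thm. 37 and Cor. 2] [cite: Cohen1993, App. B (totally real cubic fields: d = 316, h = 1)] -/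
theorem classNumber_eq_one_of_root_d316p (h3 : Module.finrank ℚ K = 3) (b : 𝓞 K)
    (hb : b ^ 3 + (-1 : ℤ) * b ^ 2 + (-4 : ℤ) * b + (2 : ℤ) = 0) : NumberField.classNumber K = 1 := by
  have hirr := irreducible_cubic_d316p
  have hd : |NumberField.discr K| ≤ (316 : ℕ) :=
    (abs_discr_le_abs_cubic_discr K h3 b hirr hb).trans (by simp only [Cubic.discr]; norm_num)
  have hM := minkowskiBound_lt_of_sqrt_le K h3 hd (s := 17.78) (B := 6)
    ((Real.sqrt_le_sqrt (by norm_num : ((316 : ℕ) : ℝ) ≤ (17.78 : ℝ) ^ 2)).trans (Real.sqrt_sq (by norm_num)).le)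
    (by norm_num)
  obtain ⟨hN2a, hN2b⟩ := dets_d316p
  have hb' : b ^ 3 - b ^ 2 - 4 * b + 2 = 0 := by push_cast at hb; linear_combination hb
  rw [NumberField.classNumber_eq_one_iff]
  refine RingOfIntegers.isPrincipalIdealRing_of_isPrincipal_of_norm_le_of_isPrime fun I hI hle ↦ ?_
  have hlt : Ideal.absNorm (I : Ideal (𝓞 K)) < 6 := by exact_mod_cast hle.trans_lt hM
  have h0 : Ideal.absNorm (I : Ideal (𝓞 K)) ≠ 0 := Ideal.absNorm_ne_zero_of_nonZeroDivisors I
  have h1 : Ideal.absNorm (I : Ideal (𝓞 K)) ≠ 1 := by rw [Ne, Ideal.absNorm_eq_one_iff]; exact hI.ne_top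
  have hmemN := Ideal.absNorm_mem (I : Ideal (𝓞 K))
  have nα2a := natAbs_norm_coords_eq K h3 b hirr hb 0 1 0 (n := 2) hN2a (by norm_num)
  have nα2b := natAbs_norm_coords_eq K h3 b hirr hb (-1) 1 0 (n := 2) hN2b (by norm_num)
  -- norm-2 elements from `θ ∈ I` or `θ − 1 ∈ I`
  have keya : b ∈ (I : Ideal (𝓞 K)) → (((0 : ℤ) : 𝓞 K) + ((1 : ℤ) : 𝓞 K) * b + ((0 : ℤ) : 𝓞 K) * b ^ 2) ∈ (I : Ideal (𝓞 K)) := by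
    intro h; have : (((0 : ℤ) : 𝓞 K) + ((1 : ℤ) : 𝓞 K) * b + ((0 : ℤ) : 𝓞 K) * b ^ 2) = b := by push_cast; ring
    rw [this]; exact h
  have keyb : b - 1 ∈ (I : Ideal (𝓞 K)) → (((-1 : ℤ) : 𝓞 K) + ((1 : ℤ) : 𝓞 K) * b + ((0 : ℤ) : 𝓞 K) * b ^ 2) ∈ (I : Ideal (𝓞 K)) := by
    intro h; have : (((-1 : ℤ) : 𝓞 K) + ((1 : ℤ) : 𝓞 K) * b + ((0 : ℤ) : 𝓞 K) * b ^ 2) = b - 1 := by push_cast; ring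
    rw [this]; exact h
  have h2le : 2 ≤ Ideal.absNorm (I : Ideal (𝓞 K)) := by omega
  interval_cases hn : Ideal.absNorm (I : Ideal (𝓞 K))
  · -- N(I) = 2
    obtain ⟨a, ha, hab⟩ := exists_sub_natCast_mem_of_absNorm_eq_prime K (by norm_num) hn b
    interval_cases a
    · exact ⟨⟨_, eq_span_singleton_of_mem_of_absNorm_eq K two_ne_zero hn (keya (by simpa using hab)) nα2a⟩⟩
    · exact ⟨⟨_, eq_span_singleton_of_mem_of_absNorm_eq K two_ne_zero hn (keyb (by simpa using hab)) nα2b⟩⟩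
  · -- N(I) = 3: impossible
    exfalso
    obtain ⟨a, ha, hab⟩ := exists_sub_natCast_mem_of_absNorm_eq_prime K (by norm_num) hn b
    have hdvd := natCast_dvd_of_sub_mem K (by norm_num) hn h3 hb hab
    interval_cases a <;> norm_num at hdvd
  · -- N(I) = 4: `2 ∈ I`, `θ²(θ − 1) = 2(2θ − 1) ∈ I`
    exfalso
    have h4 : ((4 : ℕ) : 𝓞 K) ∈ (I : Ideal (𝓞 K)) := hmemN
    have h2 : ((2 : ℕ) : 𝓞 K) ∈ (I : Ideal (𝓞 K)) := by
      have : ((4 : ℕ) : 𝓞 K) = ((2 : ℕ) : 𝓞 K) * ((2 : ℕ) : 𝓞 K) := by push_cast; norm_num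
      rw [this] at h4; exact (hI.mem_or_mem h4).elim id id
    have hprod : b * (b * (b - 1)) ∈ (I : Ideal (𝓞 K)) := by
      have : b * (b * (b - 1)) = ((2 : ℕ) : 𝓞 K) * (2 * b - 1) := by push_cast; linear_combination hb'
      rw [this]; exact Ideal.mul_mem_right _ _ h2
    have hmem2 : ∃ α ∈ (I : Ideal (𝓞 K)), (Algebra.norm ℤ α).natAbs = 2 := by
      rcases hI.mem_or_mem hprod with h | h
      · exact ⟨_, keya h, nα2a⟩
      rcases hI.mem_or_mem h with h | h
      · exact ⟨_, keya h, nα2a⟩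
      · exact ⟨_, keyb h, nα2b⟩
    obtain ⟨α, hα, hNα⟩ := hmem2
    have hdvd := Ideal.absNorm_dvd_absNorm_of_le ((Ideal.span_singleton_le_iff_mem _).mpr hα)
    rw [Ideal.absNorm_span_singleton, hNα, hn] at hdvd
    omega
  · -- N(I) = 5: impossible
    exfalso
    obtain ⟨a, ha, hab⟩ := exists_sub_natCast_mem_of_absNorm_eq_prime K (by norm_num) hn b
    have hdvd := natCast_dvd_of_sub_mem K (by norm_num) hn h3 hb hab
    interval_cases a <;> norm_num at hdvd

end Cert316

/-- `#Cl(𝓞 ℚ(θ)) = 1` for every root `θ` of `X³ − X² − 4X + 2`. KERNEL. [cite: Cohen1993, App. B (d = 316)] -/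
theorem card_classGroup_adjoin_eq_one_disc_316 {θ : AlgebraicClosure ℚ}
    (hθ : aeval θ (Cubic.toPoly ⟨1, ((-1 : ℤ) : ℚ), ((-4 : ℤ) : ℚ), ((2 : ℤ) : ℚ)⟩) = 0) :
    Nat.card (ClassGroup (𝓞 (IntermediateField.adjoin ℚ {θ}))) = 1 := by
  have hfm : (Cubic.toPoly ⟨1, ((-1 : ℤ) : ℚ), ((-4 : ℤ) : ℚ), ((2 : ℤ) : ℚ)⟩).Monic := Cubic.monic_of_a_eq_one'
  have hθint : IsIntegral ℚ θ := ⟨_, hfm, by rwa [← aeval_def]⟩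
  haveI : FiniteDimensional ℚ (IntermediateField.adjoin ℚ {θ}) := IntermediateField.adjoin.finiteDimensional hθint
  haveI : NumberField (IntermediateField.adjoin ℚ {θ}) := NumberField.mk
  obtain ⟨b, -, hb⟩ := exists_ringOfIntegers_cubic_root (p := -1) (q := -4) (r := 2) hθ
  have h1 := classNumber_eq_one_of_root_d316p _ (finrank_adjoin_eq_three_of_irreducible irreducible_cubic_d316p hθ) b hb
  rw [NumberField.classNumber, ← Nat.card_eq_fintype_card] at h1
  exact h1

/-! ## §3 The stamps -/

/-- The census curve `237952bv1` is an elliptic curve. -/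
theorem isElliptic_237952bv1' : (⟨0, ((0 : ℤ) : ℚ), 0, ((-947226241 : ℤ) : ℚ), ((-11222597935198 : ℤ) : ℚ)⟩ : WeierstrassCurve ℚ).IsElliptic :=
  isElliptic_cubicModel _ _ _ (by simp only [Cubic.discr]; norm_num)

/-- **(A)₂ for `237952bv1` from ONE parity bit** (a `C1″-RES` row of GEN 4's census: `2 = 𝔭²𝔮` in `ℚ(P)`, `d = -104`). Granted `hLim2`;
displayed: «`e_1 = 0` along the cyclotomic `ℤ₂`-extensions of `ℚ(θ)`» = `2 ∤ h(ℚ(θ, √2))` (census `cyc6 = []`); `h(ℚ(θ)) = 1` by the kernel certificate `card_classGroup_adjoin_eq_one_disc_neg104`.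
`θ` is any root of `X³ + (0)X² + (-1)X + (-2)`; KERNEL: `ℚ(P) = ℚ(β) = ℚ(θ)` (`β = -6032 + (13559)θ + (9048)θ²` is a root of the
`2`-division cubic), Fukuda's index `0` by the EVEN-INDEX CERTIFICATE `u = [-2, -1, -1]`, `v = [0, 0, -1]`, `m = [2, 1, 1]`, `m' = [4, 4, 3]`
(coordinates in `1, θ, θ²`; `N(2 − m'³) = -24734`, `8 ∤`), Fukuda Thm. 1 (1).
[cite: Lim2017FineSelmer, §3 Thm. 3.5 and Lemma 3.2] [cite: Fukuda1994, Thm. 1 (1), p. 264] -/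
theorem conjA_two_237952bv1_of_layerOneBit
    (hLim2 : Lim2017.thm35_at_two_fineSelmerDual_moduleFinite_of_classicalMuVanishes_of_le_divisionField_four)
    {θ : AlgebraicClosure ℚ} (hθ : aeval θ (Cubic.toPoly ⟨1, ((0 : ℤ) : ℚ), ((-1 : ℤ) : ℚ), ((-2 : ℤ) : ℚ)⟩) = 0)
    (h1 : haveI : FiniteDimensional ℚ (IntermediateField.adjoin ℚ {θ}) :=
        IntermediateField.adjoin.finiteDimensional ((AlgebraicClosure.isAlgebraic ℚ).isAlgebraic θ).isIntegral
      haveI : NumberField (IntermediateField.adjoin ℚ {θ}) := NumberField.mk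
      ∀ κL : ZpExtension (IntermediateField.adjoin ℚ {θ}) 2, κL.IsCyclotomic → classNumberPExp κL 1 = 0)
    (κ : ZpExtension ℚ 2) (hκ : κ.IsCyclotomic) :
    haveI := isElliptic_237952bv1'
    ∃ (γ : absoluteGaloisGroup ℚ) (D : (⟨0, ((0 : ℤ) : ℚ), 0, ((-947226241 : ℤ) : ℚ), ((-11222597935198 : ℤ) : ℚ)⟩ : WeierstrassCurve ℚ).FineSelmerDualData κ γ),
      Module.Finite ℤ_[2] (RestrictScalars ℤ_[2] (IwasawaAlgebra 2) D.X) := by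
  haveI := isElliptic_237952bv1'
  have hθ' : θ ^ 3 + (0 : AlgebraicClosure ℚ) * θ ^ 2 + (-1 : AlgebraicClosure ℚ) * θ + (-2 : AlgebraicClosure ℚ) = 0 := by
    have := hθ
    simp only [Cubic.toPoly, map_one, one_mul, aeval_add, aeval_mul, aeval_C, aeval_X_pow, aeval_X,
      eq_ratCast, Rat.cast_intCast] at this
    push_cast at this
    linear_combination this
  set β : AlgebraicClosure ℚ := algebraMap ℚ (AlgebraicClosure ℚ) (-6032 : ℚ) +
      algebraMap ℚ (AlgebraicClosure ℚ) (13559 : ℚ) * θ + algebraMap ℚ (AlgebraicClosure ℚ) (9048 : ℚ) * θ ^ 2 with hβdef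
  have hβ : aeval β (Cubic.toPoly ⟨1, ((0 : ℤ) : ℚ), ((-947226241 : ℤ) : ℚ), ((-11222597935198 : ℤ) : ℚ)⟩) = 0 := by
    simp only [Cubic.toPoly, map_one, one_mul, aeval_add, aeval_mul, aeval_C, aeval_X_pow, aeval_X, eq_ratCast,
      Rat.cast_intCast]
    rw [hβdef]
    simp only [eq_ratCast]
    push_cast
    linear_combination ((2864201857127 : AlgebraicClosure ℚ) + (4249602561672 : AlgebraicClosure ℚ) * θ + (3330075647808 : AlgebraicClosure ℚ) * θ ^ 2 + (740726318592 : AlgebraicClosure ℚ) * θ ^ 3) * hθ'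
  have hadj : IntermediateField.adjoin ℚ {β} = IntermediateField.adjoin ℚ {θ} := by
    apply le_antisymm
    · rw [IntermediateField.adjoin_simple_le_iff, hβdef]
      have hθmem := IntermediateField.mem_adjoin_simple_self ℚ θ
      exact add_mem (add_mem (algebraMap_mem _ _) (mul_mem (algebraMap_mem _ _) hθmem))
        (mul_mem (algebraMap_mem _ _) (pow_mem hθmem 2))
    · rw [IntermediateField.adjoin_simple_le_iff]
      have hθeq : θ = algebraMap ℚ (AlgebraicClosure ℚ) (-2600668496/44926453 : ℚ) +
          algebraMap ℚ (AlgebraicClosure ℚ) (-926377/584043889 : ℚ) * β +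
          algebraMap ℚ (AlgebraicClosure ℚ) (696/7592570557 : ℚ) * β ^ 2 := by
        rw [hβdef]; simp only [eq_ratCast]; push_cast
        linear_combination (((-1010491776 : AlgebraicClosure ℚ) / 44926453) + ((-337153536 : AlgebraicClosure ℚ) / 44926453) * θ) * hθ'
      rw [hθeq]
      have hβmem := IntermediateField.mem_adjoin_simple_self ℚ β
      exact add_mem (add_mem (algebraMap_mem _ _) (mul_mem (algebraMap_mem _ _) hβmem))
        (mul_mem (algebraMap_mem _ _) (pow_mem hβmem 2))
  obtain ⟨P₀, hP₀, hP₀eq⟩ := exists_geomTorsion_two_eq_some_root ((0 : ℤ) : ℚ) ((-947226241 : ℤ) : ℚ)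
    ((-11222597935198 : ℤ) : ℚ) hβ
  have hF : IntermediateField.fixedField (MulAction.stabilizer (absoluteGaloisGroup ℚ) P₀) =
      IntermediateField.adjoin ℚ {θ} := by
    rw [fixedField_stabilizer_eq_adjoin_root _ _ _ hβ hP₀eq, ← hadj]
    -- the two `Algebra ℚ ℚ̄` instance paths agree
    congr 1
  -- the even-index certificate in `𝓞 ℚ(θ)`
  have hirr := irreducible_cubic_d104n
  haveI : FiniteDimensional ℚ (IntermediateField.adjoin ℚ {θ}) :=
    IntermediateField.adjoin.finiteDimensional ((AlgebraicClosure.isAlgebraic ℚ).isAlgebraic θ).isIntegral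
  haveI : NumberField (IntermediateField.adjoin ℚ {θ}) := NumberField.mk
  obtain ⟨B, -, hB⟩ := exists_ringOfIntegers_cubic_root (p := 0) (q := -1) (r := -2) hθ
  have h3 := finrank_adjoin_eq_three_of_irreducible hirr hθ
  refine fineSelmerDual_moduleFinite_two_of_evenIndexCertificate_pointField hLim2 _ hP₀ (p := 0) (q := -1) (r := -2) hirr hθ hF
    (((-2 : ℤ) : 𝓞 (IntermediateField.adjoin ℚ {θ})) + ((-1 : ℤ) : 𝓞 (IntermediateField.adjoin ℚ {θ})) * B + ((-1 : ℤ) : 𝓞 (IntermediateField.adjoin ℚ {θ})) * B ^ 2) (((0 : ℤ) : 𝓞 (IntermediateField.adjoin ℚ {θ})) + ((0 : ℤ) : 𝓞 (IntermediateField.adjoin ℚ {θ})) * B + ((-1 : ℤ) : 𝓞 (IntermediateField.adjoin ℚ {θ})) * B ^ 2) (((2 : ℤ) : 𝓞 (IntermediateField.adjoin ℚ {θ})) + ((1 : ℤ) : 𝓞 (IntermediateField.adjoin ℚ {θ})) * B + ((1 : ℤ) : 𝓞 (IntermediateField.adjoin ℚ {θ})) * B ^ 2) (((4 : ℤ) :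 𝓞 (IntermediateField.adjoin ℚ {θ})) + ((4 : ℤ) : 𝓞 (IntermediateField.adjoin ℚ {θ})) * B + ((3 : ℤ) : 𝓞 (IntermediateField.adjoin ℚ {θ})) * B ^ 2) ?_ ?_ ?_
    (by rw [card_classGroup_adjoin_eq_one_disc_neg104 hθ]; norm_num) h1 κ hκ
  · push_cast; linear_combination (((2 : ℤ) : 𝓞 (IntermediateField.adjoin ℚ {θ})) + ((-1 : ℤ) : 𝓞 (IntermediateField.adjoin ℚ {θ})) * B) * hB
  · push_cast; linear_combination (((2 : ℤ) : 𝓞 (IntermediateField.adjoin ℚ {θ})) + ((1 : ℤ) : 𝓞 (IntermediateField.adjoin ℚ {θ})) * B) * hB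
  · have hz : (2 : 𝓞 (IntermediateField.adjoin ℚ {θ})) - (((4 : ℤ) : 𝓞 (IntermediateField.adjoin ℚ {θ})) + ((4 : ℤ) : 𝓞 (IntermediateField.adjoin ℚ {θ})) * B + ((3 : ℤ) : 𝓞 (IntermediateField.adjoin ℚ {θ})) * B ^ 2) ^ 3 =
        ((-1090 : ℤ) : 𝓞 (IntermediateField.adjoin ℚ {θ})) + (-1264 : ℤ) * B + (-831 : ℤ) * B ^ 2 := by
      push_cast; linear_combination (((-514 : ℤ) : 𝓞 (IntermediateField.adjoin ℚ {θ})) + ((-279 : ℤ) : 𝓞 (IntermediateField.adjoin ℚ {θ})) * B + ((-108 : ℤ) : 𝓞 (IntermediateField.adjoin ℚ {θ})) * B ^ 2 + ((-27 : ℤ) : 𝓞 (IntermediateField.adjoin ℚ {θ})) * B ^ 3) * hB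
    rw [hz]
    exact not_eight_dvd_norm_coords _ h3 B hirr hB (-1090) (-1264) (-831) (N := -24734)
      (by simp only [Matrix.one_fin_three, Matrix.det_fin_three, Matrix.add_apply, Matrix.smul_apply, sq, Matrix.mul_apply,
        Fin.sum_univ_three, Matrix.of_apply, Matrix.cons_val', Matrix.cons_val_zero, Matrix.cons_val_one, Matrix.cons_val_two,
        Matrix.head_cons, Matrix.tail_cons, Matrix.empty_val', Matrix.cons_val_fin_one, smul_eq_mul]; norm_num) (by norm_num)

/-- The census curve `261648q1` is an elliptic curve. -/
theorem isElliptic_261648q1' : (⟨0, ((0 : ℤ) : ℚ), 0, ((-3540805887 : ℤ) : ℚ), ((-81096346959158 : ℤ) : ℚ)⟩ : WeierstrassCurve ℚ).IsElliptic :=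
  isElliptic_cubicModel _ _ _ (by simp only [Cubic.discr]; norm_num)

/-- **(A)₂ for `261648q1` from ONE parity bit** (a `C1″-RES` row of GEN 4's census: `2 = 𝔭²𝔮` in `ℚ(P)`, `d = 316`). Granted `hLim2`;
displayed: «`e_1 = 0` along the cyclotomic `ℤ₂`-extensions of `ℚ(θ)`» = `2 ∤ h(ℚ(θ, √2))` (census `cyc6 = []`); `h(ℚ(θ)) = 1` by the kernel certificate `card_classGroup_adjoin_eq_one_disc_316`.
`θ` is any root of `X³ + (-1)X² + (-4)X + (2)`; KERNEL: `ℚ(P) = ℚ(β) = ℚ(θ)` (`β = 68045 + (12756)θ + (-24099)θ²` is a root of the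
`2`-division cubic), Fukuda's index `0` by the EVEN-INDEX CERTIFICATE `u = [-2, -2, 0]`, `v = [0, -1, -1]`, `m = [4, -3, -3]`, `m' = [-19, 33, 24]`
(coordinates in `1, θ, θ²`; `N(2 − m'³) = 59395626`, `8 ∤`), Fukuda Thm. 1 (1).
[cite: Lim2017FineSelmer, §3 Thm. 3.5 and Lemma 3.2] [cite: Fukuda1994, Thm. 1 (1), p. 264] -/
theorem conjA_two_261648q1_of_layerOneBit
    (hLim2 : Lim2017.thm35_at_two_fineSelmerDual_moduleFinite_of_classicalMuVanishes_of_le_divisionField_four)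
    {θ : AlgebraicClosure ℚ} (hθ : aeval θ (Cubic.toPoly ⟨1, ((-1 : ℤ) : ℚ), ((-4 : ℤ) : ℚ), ((2 : ℤ) : ℚ)⟩) = 0)
    (h1 : haveI : FiniteDimensional ℚ (IntermediateField.adjoin ℚ {θ}) :=
        IntermediateField.adjoin.finiteDimensional ((AlgebraicClosure.isAlgebraic ℚ).isAlgebraic θ).isIntegral
      haveI : NumberField (IntermediateField.adjoin ℚ {θ}) := NumberField.mk
      ∀ κL : ZpExtension (IntermediateField.adjoin ℚ {θ}) 2, κL.IsCyclotomic → classNumberPExp κL 1 = 0)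
    (κ : ZpExtension ℚ 2) (hκ : κ.IsCyclotomic) :
    haveI := isElliptic_261648q1'
    ∃ (γ : absoluteGaloisGroup ℚ) (D : (⟨0, ((0 : ℤ) : ℚ), 0, ((-3540805887 : ℤ) : ℚ), ((-81096346959158 : ℤ) : ℚ)⟩ : WeierstrassCurve ℚ).FineSelmerDualData κ γ),
      Module.Finite ℤ_[2] (RestrictScalars ℤ_[2] (IwasawaAlgebra 2) D.X) := by
  haveI := isElliptic_261648q1'
  have hθ' : θ ^ 3 + (-1 : AlgebraicClosure ℚ) * θ ^ 2 + (-4 : AlgebraicClosure ℚ) * θ + (2 : AlgebraicClosure ℚ) = 0 := by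
    have := hθ
    simp only [Cubic.toPoly, map_one, one_mul, aeval_add, aeval_mul, aeval_C, aeval_X_pow, aeval_X,
      eq_ratCast, Rat.cast_intCast] at this
    push_cast at this
    linear_combination this
  set β : AlgebraicClosure ℚ := algebraMap ℚ (AlgebraicClosure ℚ) (68045 : ℚ) +
      algebraMap ℚ (AlgebraicClosure ℚ) (12756 : ℚ) * θ + algebraMap ℚ (AlgebraicClosure ℚ) (-24099 : ℚ) * θ ^ 2 with hβdef
  have hβ : aeval β (Cubic.toPoly ⟨1, ((0 : ℤ) : ℚ), ((-3540805887 : ℤ) : ℚ), ((-81096346959158 : ℤ) : ℚ)⟩) = 0 := by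
    simp only [Cubic.toPoly, map_one, one_mul, aeval_add, aeval_mul, aeval_C, aeval_X_pow, aeval_X, eq_ratCast,
      Rat.cast_intCast]
    rw [hβdef]
    simp only [eq_ratCast]
    push_cast
    linear_combination ((-3486915174474 : AlgebraicClosure ℚ) + (59035664530116 : AlgebraicClosure ℚ) * θ + (8228813958369 : AlgebraicClosure ℚ) * θ ^ 2 + (-13995778642299 : AlgebraicClosure ℚ) * θ ^ 3) * hθ'
  have hadj : IntermediateField.adjoin ℚ {β} = IntermediateField.adjoin ℚ {θ} := by
    apply le_antisymm
    · rw [IntermediateField.adjoin_simple_le_iff, hβdef]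
      have hθmem := IntermediateField.mem_adjoin_simple_self ℚ θ
      exact add_mem (add_mem (algebraMap_mem _ _) (mul_mem (algebraMap_mem _ _) hθmem))
        (mul_mem (algebraMap_mem _ _) (pow_mem hθmem 2))
    · rw [IntermediateField.adjoin_simple_le_iff]
      have hθeq : θ = algebraMap ℚ (AlgebraicClosure ℚ) (-9481097860256/109503 : ℚ) +
          algebraMap ℚ (AlgebraicClosure ℚ) (-275974019/219006 : ℚ) * β +
          algebraMap ℚ (AlgebraicClosure ℚ) (8033/219006 : ℚ) * β ^ 2 := by
        rw [hβdef]; simp only [eq_ratCast]; push_cast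
        linear_combination (((30393200919 : AlgebraicClosure ℚ) / 24334) + ((-518362171937 : AlgebraicClosure ℚ) / 24334) * θ) * hθ'
      rw [hθeq]
      have hβmem := IntermediateField.mem_adjoin_simple_self ℚ β
      exact add_mem (add_mem (algebraMap_mem _ _) (mul_mem (algebraMap_mem _ _) hβmem))
        (mul_mem (algebraMap_mem _ _) (pow_mem hβmem 2))
  obtain ⟨P₀, hP₀, hP₀eq⟩ := exists_geomTorsion_two_eq_some_root ((0 : ℤ) : ℚ) ((-3540805887 : ℤ) : ℚ)
    ((-81096346959158 : ℤ) : ℚ) hβ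
  have hF : IntermediateField.fixedField (MulAction.stabilizer (absoluteGaloisGroup ℚ) P₀) =
      IntermediateField.adjoin ℚ {θ} := by
    rw [fixedField_stabilizer_eq_adjoin_root _ _ _ hβ hP₀eq, ← hadj]
    -- the two `Algebra ℚ ℚ̄` instance paths agree
    congr 1
  -- the even-index certificate in `𝓞 ℚ(θ)`
  have hirr := irreducible_cubic_d316p
  haveI : FiniteDimensional ℚ (IntermediateField.adjoin ℚ {θ}) :=
    IntermediateField.adjoin.finiteDimensional ((AlgebraicClosure.isAlgebraic ℚ).isAlgebraic θ).isIntegral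
  haveI : NumberField (IntermediateField.adjoin ℚ {θ}) := NumberField.mk
  obtain ⟨B, -, hB⟩ := exists_ringOfIntegers_cubic_root (p := -1) (q := -4) (r := 2) hθ
  have h3 := finrank_adjoin_eq_three_of_irreducible hirr hθ
  refine fineSelmerDual_moduleFinite_two_of_evenIndexCertificate_pointField hLim2 _ hP₀ (p := -1) (q := -4) (r := 2) hirr hθ hF
    (((-2 : ℤ) : 𝓞 (IntermediateField.adjoin ℚ {θ})) + ((-2 : ℤ) : 𝓞 (IntermediateField.adjoin ℚ {θ})) * B + ((0 : ℤ) : 𝓞 (IntermediateField.adjoin ℚ {θ})) * B ^ 2) (((0 : ℤ) : 𝓞 (IntermediateField.adjoin ℚ {θ})) + ((-1 : ℤ) : 𝓞 (IntermediateField.adjoin ℚ {θ})) * B + ((-1 : ℤ) : 𝓞 (IntermediateField.adjoin ℚ {θ})) * B ^ 2) (((4 : ℤ) : 𝓞 (IntermediateField.adjoin ℚ {θ})) + ((-3 : ℤ) : 𝓞 (IntermediateField.adjoin ℚ {θ})) * B + ((-3 : ℤ) : 𝓞 (IntermediateField.adjoin ℚ {θ})) * B ^ 2) (((-19 : ℤ)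 : 𝓞 (IntermediateField.adjoin ℚ {θ})) + ((33 : ℤ) : 𝓞 (IntermediateField.adjoin ℚ {θ})) * B + ((24 : ℤ) : 𝓞 (IntermediateField.adjoin ℚ {θ})) * B ^ 2) ?_ ?_ ?_
    (by rw [card_classGroup_adjoin_eq_one_disc_316 hθ]; norm_num) h1 κ hκ
  · push_cast; linear_combination (((-6 : ℤ) : 𝓞 (IntermediateField.adjoin ℚ {θ})) + ((-2 : ℤ) : 𝓞 (IntermediateField.adjoin ℚ {θ})) * B) * hB
  · push_cast; linear_combination (((27 : ℤ) : 𝓞 (IntermediateField.adjoin ℚ {θ})) + ((9 : ℤ) : 𝓞 (IntermediateField.adjoin ℚ {θ})) * B) * hB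
  · have hz : (2 : 𝓞 (IntermediateField.adjoin ℚ {θ})) - (((-19 : ℤ) : 𝓞 (IntermediateField.adjoin ℚ {θ})) + ((33 : ℤ) : 𝓞 (IntermediateField.adjoin ℚ {θ})) * B + ((24 : ℤ) : 𝓞 (IntermediateField.adjoin ℚ {θ})) * B ^ 2) ^ 3 =
        ((753087 : ℤ) : 𝓞 (IntermediateField.adjoin ℚ {θ})) + (-1184751 : ℤ) * B + (-882216 : ℤ) * B ^ 2 := by
      push_cast; linear_combination (((-373113 : ℤ) : 𝓞 (IntermediateField.adjoin ℚ {θ})) + ((-171720 : ℤ) : 𝓞 (IntermediateField.adjoin ℚ {θ})) * B + ((-70848 : ℤ) : 𝓞 (IntermediateField.adjoin ℚ {θ})) * B ^ 2 + ((-13824 : ℤ) : 𝓞 (IntermediateField.adjoin ℚ {θ})) * B ^ 3) * hB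
    rw [hz]
    exact not_eight_dvd_norm_coords _ h3 B hirr hB (753087) (-1184751) (-882216) (N := 59395626)
      (by simp only [Matrix.one_fin_three, Matrix.det_fin_three, Matrix.add_apply, Matrix.smul_apply, sq, Matrix.mul_apply,
        Fin.sum_univ_three, Matrix.of_apply, Matrix.cons_val', Matrix.cons_val_zero, Matrix.cons_val_one, Matrix.cons_val_two,
        Matrix.head_cons, Matrix.tail_cons, Matrix.empty_val', Matrix.cons_val_fin_one, smul_eq_mul]; norm_num) (by norm_num)

end Summit.BirchSwinnertonDyer.BirchSwinnertonDyer.Theorems.AddKatoTwo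

end
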